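import Literature.Algebra.Lie.LefschetzModuleWeylOperator
import HarnessLib

/-!
# Transport of the Lefschetz operators `ᶜΛ`, `*_L`, `∗`, `w`, `*_H` and of the Künneth projectors along a linear map
# intertwining two Lefschetz modules ("les opérateurs … sont compatibles à l'extension des scalaires et aux isomorphismes")

[topic Algebra/Lie]

Layer `Literature/Algebra/Lie`, lane `lit-hodgefound` (Track 2 foundations library; prover seat `lit-hodgefound-p34`, generation 31,
row g31-#8). THEOREMS ONLY (no `def`, no named fact, no instance, no notation; net debt `0`).

THE SETTING. `(M, h, e)` is a Lefschetz module over a field `K` of characteristic `0` (`L : HasLefschetzProperty h e`,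
`hgr : IsZGrading h`), `(M', h', e')` a Lefschetz module over a field extension `K'` of `K` (`[Algebra K K']`, `M'` a `K'`-space
regarded as a `K`-space through the tower), and `Φ : M →ₗ[K] M'` a `K`-linear map INTERTWINING the two structures:
`Φ (h x) = h' (Φ x)` and `Φ (e x) = e' (Φ x)`. Two cases matter downstream: `K' = K` and `Φ` an isomorphism of Lefschetz modules
(e.g. the Künneth isomorphism `⋀(W₁ ⊕ W₂) ≅ ⋀W₁ ⊗ ⋀W₂`, André §1.3), and `K ⊂ K'` with `Φ` the extension of scalars
(`Θ : ⋀_ℚ V → ⋀_ℂ V_ℂ`, the case of rows g29-#6 / g31-#7, where the statements below were proved ad hoc for `*_L`, `∗`, `w`, `*_H`).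

THE POINT. Every operator that André attaches to a Lefschetz module through the Lefschetz (string) decomposition — `ᶜΛ`
(`HasLefschetzProperty.dual`), `*_L` (`lefschetzInvolution`), Milne's `∗` (`hodgeInvolution d`), the Weyl element `w` (`weylOperator`),
André's `*_H` (`andreHodgeInvolution d`) — is given on a string `eʲ p` (`p ∈ P_{-k}`, `j ≤ k`) by a universal formula
`c(k, j) · e^{ι(k,j)} p` with a RATIONAL (indeed integral up to the factorials of `w`, `*_H`) coefficient `c(k, j)`; since `Φ` maps
strings to strings of the same type (`Φ P_{-k}(M) ⊆ P_{-k}(M')`, `Φ eʲ = e'ʲ Φ`) and `M` is spanned by its strings, `Φ` intertwines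
each of these operators with its primed counterpart. Likewise for the Künneth (degree) projectors.

## Sources, VERBATIM

Y. André, *Pour une théorie inconditionnelle des motifs*, Publ. Math. IHÉS **83** (1996) [Andre1996Motifs], §1.1 (p. 10): "`*_L x =
Σ L^{d-j+k} x_{j-2k}`, `*_H x = Σ (-1)^{(j-2k)(j-2k+1)/2} (k!/(d-j+k)!) L^{d-j+k} x_{j-2k}`, `ᶜΛ x = Σ k(d-j+k+1) L^{k-1} x_{j-2k}`"
(formulas on the Lefschetz decomposition `x = Σ Lᵏ x_{j-2k}`, `x_{j-2k}` primitive, with coefficients in `ℚ` — "ces opérateurs sont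
définis sur le corps de coefficients `Q_ν` quelconque"), §1.2 (p. 11: "Notons `πʲ` le projecteur de Künneth sur `Hʲ(X)`, et posons
`h = Σ (d-j) πʲ`"), §1.3 (pp. 12–13: compatibility of `*`, `ᶜΛ` with products through the Künneth isomorphism, Lemme 1.3.1–1.3.2).
E. Looijenga, V. Lunts, *A Lie algebra attached to a projective variety*, Invent. Math. **129** (1997) [LooijengaLunts1997], §1 (1.1)
(p. 4): "there exists a unique `K`-linear transformation `f` in `M` of degree `-2` such that `[e, f] = h`" (uniqueness ⇒ functoriality
under isomorphisms and base change).
H. Lange, *Abelian Varieties over the Complex Numbers* (2023) [Lange2023AbelianVarietiesComplex], §7.3.2 (p. 338: the Lefschetz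
decomposition "(3)" is compatible with extension of scalars and with the symplectic group).

## What is PROVED (`Φ : M →ₗ[K] M'`, `hh : ∀ x, Φ (h x) = h' (Φ x)`, `he : ∀ x, Φ (e x) = e' (Φ x)`)

* §0 `apply_mem_degreeSpace_of_semiconj` (`Φ M_m ⊆ M'_m`), `apply_pow_of_semiconj` (`Φ eʲ = e'ʲ Φ`),
  `apply_mem_primitiveSpace_of_semiconj` (`Φ P_{-k} ⊆ P'_{-k}`), `map_degreeProj_of_semiconj` (`Φ π_m = π'_m Φ` for Künneth projectors).
* §1 **`HasLefschetzProperty.map_dual_of_semiconj` (`Φ ᶜΛ = ᶜΛ' Φ`), `map_lefschetzInvolution_of_semiconj` (`Φ *_L = *_L' Φ`),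
  `map_hodgeInvolution_of_semiconj` (`Φ ∗_d = ∗'_d Φ`), `map_weylOperator_of_semiconj` (`Φ w = w' Φ`),
  `map_andreHodgeInvolution_of_semiconj` (`Φ *_H = *_H' Φ`)** — all by string extensionality (`linearMap_ext_of_strings`) and the
  string formulas of the operators, the rational coefficients being pushed through `algebraMap K K'`.
* §2 the case of a linear equivalence over one field: `map_dual_of_semiconj'` etc. are the same statements (`K' = K`); recorded as the
  conjugation identities **`LinearEquiv.conj_dual_eq`**, **`LinearEquiv.conj_weylOperator_eq`**, **`LinearEquiv.conj_andreHodgeInvolution_eq`**,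
  `LinearEquiv.conj_lefschetzInvolution_eq`, `LinearEquiv.conj_hodgeInvolution_eq` (`Φ T Φ⁻¹ = T'`).

## References

* [Andre1996Motifs] Y. André, *Pour une théorie inconditionnelle des motifs*, Publ. Math. IHÉS 83 (1996), §1.1–§1.3 (pp. 10–13).
* [LooijengaLunts1997] E. Looijenga, V. Lunts, *A Lie algebra attached to a projective variety*, Invent. Math. 129 (1997), §1 (1.1) p. 4.
* [Lange2023AbelianVarietiesComplex] H. Lange, *Abelian Varieties over the Complex Numbers* (2023), §7.3.2 (p. 338).
-/

noncomputable section

open scoped Nat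

namespace Literature.Algebra.Lie

open HasLefschetzProperty (primitiveSpace mem_primitiveSpace_iff)

variable {K : Type*} [Field K] {K' : Type*} [Field K'] [Algebra K K']
  {M : Type*} [AddCommGroup M] [Module K M]
  {M' : Type*} [AddCommGroup M'] [Module K' M'] [Module K M'] [IsScalarTower K K' M']
  {h e : Module.End K M} {h' e' : Module.End K' M'} {Φ : M →ₗ[K] M'}

/-! ## §0 `Φ` maps weight spaces, strings and primitive parts to their counterparts -/

/-- **`Φ M_m ⊆ M'_m`** when `Φ h = h' Φ` (`h' (Φ x) = Φ (m x) = m Φ x`). [cite: Andre1996Motifs, §1.2 (p. 11)]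
[cite: LooijengaLunts1997, §1 (1.1) p. 4] -/
theorem apply_mem_degreeSpace_of_semiconj (hh : ∀ x, Φ (h x) = h' (Φ x)) {m : ℤ} {x : M} (hx : x ∈ degreeSpace h m) :
    Φ x ∈ degreeSpace h' m := by
  rw [mem_degreeSpace_iff, ← hh, mem_degreeSpace_iff.1 hx, map_smul, ← algebraMap_smul K' (m : K), map_intCast]

omit [Algebra K K'] [IsScalarTower K K' M'] in
/-- **`Φ eʲ = e'ʲ Φ`** when `Φ e = e' Φ`. [cite: Andre1996Motifs, §1.1 (p. 10)] -/
theorem apply_pow_of_semiconj (he : ∀ x, Φ (e x) = e' (Φ x)) (j : ℕ) (x : M) : Φ ((e ^ j) x) = (e' ^ j) (Φ x) := by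
  induction j with
  | zero => rw [pow_zero, pow_zero, Module.End.one_apply, Module.End.one_apply]
  | succ j ih => rw [pow_succ', pow_succ', Module.End.mul_apply, Module.End.mul_apply, he, ih]

/-- **`Φ P_{-k}(M) ⊆ P_{-k}(M')`** (`P_{-k} = M_{-k} ∩ ker e^{k+1}`). [cite: Andre1996Motifs, §1.1 (p. 10, primitive decomposition)]
[cite: Lange2023AbelianVarietiesComplex, §7.3.2 (p. 338)] -/
theorem apply_mem_primitiveSpace_of_semiconj (hh : ∀ x, Φ (h x) = h' (Φ x)) (he : ∀ x, Φ (e x) = e' (Φ x)) {k : ℕ} {p : M}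
    (hp : p ∈ primitiveSpace h e k) : Φ p ∈ primitiveSpace h' e' k := by
  rw [mem_primitiveSpace_iff] at hp ⊢
  exact ⟨apply_mem_degreeSpace_of_semiconj hh hp.1, by rw [← apply_pow_of_semiconj he, hp.2, map_zero]⟩

/-- **`Φ` intertwines the Künneth (degree) projectors: `Φ (π_m x) = π'_m (Φ x)`** for projectors `π_m` of `M = ⊕ M_k` onto `M_m`
and `π'_m` of `M' = ⊕ M'_k` onto `M'_m`. [cite: Andre1996Motifs, §1.2 (p. 11, "πʲ le projecteur de Künneth") and §1.3 (p. 12)] -/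
theorem map_degreeProj_of_semiconj (hh : ∀ x, Φ (h x) = h' (Φ x)) (hgr : IsZGrading h) {m : ℤ} {π : Module.End K M}
    (hπ : ∀ (k : ℤ) (x : M), x ∈ degreeSpace h k → π x = if k = m then x else 0) {π' : Module.End K' M'}
    (hπ' : ∀ (k : ℤ) (y : M'), y ∈ degreeSpace h' k → π' y = if k = m then y else 0) (x : M) :
    Φ (π x) = π' (Φ x) := by
  have hx : x ∈ ⨆ k : ℤ, degreeSpace h k := by rw [hgr]; exact Submodule.mem_top
  refine Submodule.iSup_induction (fun k : ℤ ↦ degreeSpace h k) (motive := fun x ↦ Φ (π x) = π' (Φ x)) hx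
    (fun k x hx ↦ ?_) (by simp only [map_zero]) (fun x y hx hy ↦ by simp only [map_add, hx, hy])
  rw [hπ k x hx, hπ' k (Φ x) (apply_mem_degreeSpace_of_semiconj hh hx)]
  split_ifs
  · rfl
  · rw [map_zero]

/-! ## §1 `Φ` intertwines `ᶜΛ`, `*_L`, `∗`, `w`, `*_H` -/

namespace HasLefschetzProperty

variable [CharZero K] [CharZero K'] [FiniteDimensional K M] [FiniteDimensional K' M']

/-- **`Φ ᶜΛ = ᶜΛ' Φ`**: on a string, `ᶜΛ (e^{j+1} p) = (j+1)(k-j) eʲ p` on both sides and `ᶜΛ p = 0` (the uniqueness of `f` with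
`[e, f] = h`, read functorially). [cite: LooijengaLunts1997, §1 (1.1) p. 4] [cite: Andre1996Motifs, §1.1 (p. 10, formula for ᶜΛ) and §1.3 (p. 12)] -/
theorem map_dual_of_semiconj (L : HasLefschetzProperty h e) (hgr : IsZGrading h) (L' : HasLefschetzProperty h' e')
    (hgr' : IsZGrading h') (hh : ∀ x, Φ (h x) = h' (Φ x)) (he : ∀ x, Φ (e x) = e' (Φ x)) (x : M) :
    Φ (L.dual hgr x) = L'.dual hgr' (Φ x) := by
  suffices hΦ : Φ ∘ₗ L.dual hgr = (L'.dual hgr').restrictScalars K ∘ₗ Φ from LinearMap.congr_fun hΦ x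
  refine L.linearMap_ext_of_strings hgr fun k p hp j hj ↦ ?_
  rw [LinearMap.comp_apply, LinearMap.comp_apply, LinearMap.restrictScalars_apply]
  cases j with
  | zero =>
    rw [pow_zero, Module.End.one_apply, L.dual_apply_primitive hgr hp,
      L'.dual_apply_primitive hgr' (apply_mem_primitiveSpace_of_semiconj hh he hp), map_zero]
  | succ j =>
    rw [L.dual_apply_pow_primitive hgr hp j, apply_pow_of_semiconj he,
      L'.dual_apply_pow_primitive hgr' (apply_mem_primitiveSpace_of_semiconj hh he hp) j, map_smul, apply_pow_of_semiconj he,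
      ← algebraMap_smul K' ((((j + 1) * (k - j) : ℤ) : K)), map_intCast]

omit [FiniteDimensional K' M'] in
/-- **`Φ *_L = *_L' Φ`**: both reverse the strings, `*_L (eʲ p) = e^{k-j} p`. [cite: Andre1996Motifs, §1.1 (p. 10, definition of *_L) and §1.3 (p. 12)]
[cite: Lange2023AbelianVarietiesComplex, §7.3.2 (3) (p. 338)] -/
theorem map_lefschetzInvolution_of_semiconj (L : HasLefschetzProperty h e) (hgr : IsZGrading h) (L' : HasLefschetzProperty h' e')
    (hgr' : IsZGrading h') (hh : ∀ x, Φ (h x) = h' (Φ x)) (he : ∀ x, Φ (e x) = e' (Φ x)) (x : M) :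
    Φ (L.lefschetzInvolution hgr x) = L'.lefschetzInvolution hgr' (Φ x) := by
  suffices hΦ : Φ ∘ₗ L.lefschetzInvolution hgr = (L'.lefschetzInvolution hgr').restrictScalars K ∘ₗ Φ from
    LinearMap.congr_fun hΦ x
  refine L.linearMap_ext_of_strings hgr fun k p hp j hj ↦ ?_
  rw [LinearMap.comp_apply, LinearMap.comp_apply, LinearMap.restrictScalars_apply,
    (L.isStringReversal_lefschetzInvolution hgr) hp hj, apply_pow_of_semiconj he, apply_pow_of_semiconj he,
    (L'.isStringReversal_lefschetzInvolution hgr') (apply_mem_primitiveSpace_of_semiconj hh he hp) hj]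

/-- **`Φ ∗_d = ∗'_d Φ`** (Milne's `∗`, the signed string reversal `(-1)^{(d-k)(d-k+1)/2} e^{k-j} p`). [cite: Milne1999LefschetzClasses, §5 p. 664]
[cite: Andre1996Motifs, §1.3 (p. 12)] -/
theorem map_hodgeInvolution_of_semiconj (L : HasLefschetzProperty h e) (hgr : IsZGrading h) (L' : HasLefschetzProperty h' e')
    (hgr' : IsZGrading h') (hh : ∀ x, Φ (h x) = h' (Φ x)) (he : ∀ x, Φ (e x) = e' (Φ x)) (d : ℕ) (x : M) :
    Φ (L.hodgeInvolution hgr d x) = L'.hodgeInvolution hgr' d (Φ x) := by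
  suffices hΦ : Φ ∘ₗ L.hodgeInvolution hgr d = (L'.hodgeInvolution hgr' d).restrictScalars K ∘ₗ Φ from
    LinearMap.congr_fun hΦ x
  refine L.linearMap_ext_of_strings hgr fun k p hp j hj ↦ ?_
  rw [LinearMap.comp_apply, LinearMap.comp_apply, LinearMap.restrictScalars_apply,
    L.hodgeInvolution_apply_pow_primitive hgr d hp hj, map_smul, apply_pow_of_semiconj he, apply_pow_of_semiconj he,
    L'.hodgeInvolution_apply_pow_primitive hgr' d (apply_mem_primitiveSpace_of_semiconj hh he hp) hj,
    ← algebraMap_smul K' ((-1 : K) ^ ((d - k) * (d - k + 1) / 2)), map_pow, map_neg, map_one]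

/-- **`Φ w = w' Φ`** for the Weyl elements `w = exp(ᶜΛ) exp(-e) exp(ᶜΛ)` (`w (eʲ p) = (-1)^{k+j} (j!/(k-j)!) e^{k-j} p` on both
sides). [cite: Andre1996Motifs, §1.2 (p. 11) and §1.3 (pp. 12–13, Lemme 1.3.2 via "(0 1 ; −1 0)")] -/
theorem map_weylOperator_of_semiconj (L : HasLefschetzProperty h e) (hgr : IsZGrading h) (L' : HasLefschetzProperty h' e')
    (hgr' : IsZGrading h') (hh : ∀ x, Φ (h x) = h' (Φ x)) (he : ∀ x, Φ (e x) = e' (Φ x)) (x : M) :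
    Φ (L.weylOperator hgr x) = L'.weylOperator hgr' (Φ x) := by
  suffices hΦ : Φ ∘ₗ L.weylOperator hgr = (L'.weylOperator hgr').restrictScalars K ∘ₗ Φ from LinearMap.congr_fun hΦ x
  refine L.linearMap_ext_of_strings hgr fun k p hp j hj ↦ ?_
  rw [LinearMap.comp_apply, LinearMap.comp_apply, LinearMap.restrictScalars_apply,
    L.weylOperator_apply_pow_primitive hgr hp hj, map_smul, apply_pow_of_semiconj he, apply_pow_of_semiconj he,
    L'.weylOperator_apply_pow_primitive hgr' (apply_mem_primitiveSpace_of_semiconj hh he hp) hj,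
    ← algebraMap_smul K' ((-1 : K) ^ (k + j) * ((j ! : ℕ) : K) * (((k - j) ! : ℕ) : K)⁻¹), map_mul, map_mul, map_inv₀,
    map_natCast, map_natCast, map_pow, map_neg, map_one]

/-- **`Φ *_H = *_H' Φ`** for André's involutions with the same `d` (`*_H (eʲ p) = (-1)^{(d-k)(d-k+1)/2} (j!/(k-j)!) e^{k-j} p` on
both sides). [cite: Andre1996Motifs, §1.1 (p. 10) and §1.3 (pp. 12–13)] -/
theorem map_andreHodgeInvolution_of_semiconj (L : HasLefschetzProperty h e) (hgr : IsZGrading h)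
    (L' : HasLefschetzProperty h' e') (hgr' : IsZGrading h') (hh : ∀ x, Φ (h x) = h' (Φ x)) (he : ∀ x, Φ (e x) = e' (Φ x))
    (d : ℕ) (x : M) :
    Φ (L.andreHodgeInvolution hgr d x) = L'.andreHodgeInvolution hgr' d (Φ x) := by
  suffices hΦ : Φ ∘ₗ L.andreHodgeInvolution hgr d = (L'.andreHodgeInvolution hgr' d).restrictScalars K ∘ₗ Φ from
    LinearMap.congr_fun hΦ x
  refine L.linearMap_ext_of_strings hgr fun k p hp j hj ↦ ?_
  rw [LinearMap.comp_apply, LinearMap.comp_apply, LinearMap.restrictScalars_apply,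
    L.andreHodgeInvolution_apply_pow_primitive hgr d hp hj, map_smul, apply_pow_of_semiconj he, apply_pow_of_semiconj he,
    L'.andreHodgeInvolution_apply_pow_primitive hgr' d (apply_mem_primitiveSpace_of_semiconj hh he hp) hj,
    ← algebraMap_smul K' ((-1 : K) ^ ((d - k) * (d - k + 1) / 2) * ((j ! : ℕ) : K) * (((k - j) ! : ℕ) : K)⁻¹), map_mul, map_mul,
    map_inv₀, map_natCast, map_natCast, map_pow, map_neg, map_one]

end HasLefschetzProperty

/-! ## §2 Isomorphic Lefschetz modules over one field: `Φ T Φ⁻¹ = T'` -/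

namespace HasLefschetzProperty

variable [CharZero K] [FiniteDimensional K M] {N : Type*} [AddCommGroup N] [Module K N] [FiniteDimensional K N]
  {hN eN : Module.End K N}

/-- **`Φ ᶜΛ Φ⁻¹ = ᶜΛ'`** for an isomorphism `Φ` of Lefschetz modules. [cite: LooijengaLunts1997, §1 (1.1) p. 4 (uniqueness of f)]
[cite: Andre1996Motifs, §1.3 (p. 12)] -/
theorem conj_dual_eq (L : HasLefschetzProperty h e) (hgr : IsZGrading h) (L' : HasLefschetzProperty hN eN) (hgr' : IsZGrading hN)
    (Φ : M ≃ₗ[K] N) (hh : ∀ x, Φ (h x) = hN (Φ x)) (he : ∀ x, Φ (e x) = eN (Φ x)) :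
    Φ.conj (L.dual hgr) = L'.dual hgr' := by
  ext y
  have h1 := L.map_dual_of_semiconj hgr L' hgr' (Φ := Φ.toLinearMap) hh he (Φ.symm y)
  rw [LinearEquiv.coe_coe, LinearEquiv.apply_symm_apply] at h1
  rw [LinearEquiv.conj_apply_apply, h1]

omit [FiniteDimensional K N] in
/-- **`Φ *_L Φ⁻¹ = *_L'`.** [cite: Andre1996Motifs, §1.1 (p. 10) and §1.3 (p. 12)] -/
theorem conj_lefschetzInvolution_eq (L : HasLefschetzProperty h e) (hgr : IsZGrading h) (L' : HasLefschetzProperty hN eN)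
    (hgr' : IsZGrading hN) (Φ : M ≃ₗ[K] N) (hh : ∀ x, Φ (h x) = hN (Φ x)) (he : ∀ x, Φ (e x) = eN (Φ x)) :
    Φ.conj (L.lefschetzInvolution hgr) = L'.lefschetzInvolution hgr' := by
  ext y
  have h1 := L.map_lefschetzInvolution_of_semiconj hgr L' hgr' (Φ := Φ.toLinearMap) hh he (Φ.symm y)
  rw [LinearEquiv.coe_coe, LinearEquiv.apply_symm_apply] at h1
  rw [LinearEquiv.conj_apply_apply, h1]

/-- **`Φ ∗_d Φ⁻¹ = ∗'_d`.** [cite: Milne1999LefschetzClasses, §5 p. 664] [cite: Andre1996Motifs, §1.3 (p. 12)] -/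
theorem conj_hodgeInvolution_eq (L : HasLefschetzProperty h e) (hgr : IsZGrading h) (L' : HasLefschetzProperty hN eN)
    (hgr' : IsZGrading hN) (Φ : M ≃ₗ[K] N) (hh : ∀ x, Φ (h x) = hN (Φ x)) (he : ∀ x, Φ (e x) = eN (Φ x)) (d : ℕ) :
    Φ.conj (L.hodgeInvolution hgr d) = L'.hodgeInvolution hgr' d := by
  ext y
  have h1 := L.map_hodgeInvolution_of_semiconj hgr L' hgr' (Φ := Φ.toLinearMap) hh he d (Φ.symm y)
  rw [LinearEquiv.coe_coe, LinearEquiv.apply_symm_apply] at h1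
  rw [LinearEquiv.conj_apply_apply, h1]

/-- **`Φ w Φ⁻¹ = w'`.** [cite: Andre1996Motifs, §1.2 (p. 11) and §1.3 (pp. 12–13)] -/
theorem conj_weylOperator_eq (L : HasLefschetzProperty h e) (hgr : IsZGrading h) (L' : HasLefschetzProperty hN eN)
    (hgr' : IsZGrading hN) (Φ : M ≃ₗ[K] N) (hh : ∀ x, Φ (h x) = hN (Φ x)) (he : ∀ x, Φ (e x) = eN (Φ x)) :
    Φ.conj (L.weylOperator hgr) = L'.weylOperator hgr' := by
  ext y
  have h1 := L.map_weylOperator_of_semiconj hgr L' hgr' (Φ := Φ.toLinearMap) hh he (Φ.symm y)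
  rw [LinearEquiv.coe_coe, LinearEquiv.apply_symm_apply] at h1
  rw [LinearEquiv.conj_apply_apply, h1]

/-- **`Φ *_H Φ⁻¹ = *_H'`** (same `d`). [cite: Andre1996Motifs, §1.1 (p. 10) and §1.3 (pp. 12–13)] -/
theorem conj_andreHodgeInvolution_eq (L : HasLefschetzProperty h e) (hgr : IsZGrading h) (L' : HasLefschetzProperty hN eN)
    (hgr' : IsZGrading hN) (Φ : M ≃ₗ[K] N) (hh : ∀ x, Φ (h x) = hN (Φ x)) (he : ∀ x, Φ (e x) = eN (Φ x)) (d : ℕ) :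
    Φ.conj (L.andreHodgeInvolution hgr d) = L'.andreHodgeInvolution hgr' d := by
  ext y
  have h1 := L.map_andreHodgeInvolution_of_semiconj hgr L' hgr' (Φ := Φ.toLinearMap) hh he d (Φ.symm y)
  rw [LinearEquiv.coe_coe, LinearEquiv.apply_symm_apply] at h1
  rw [LinearEquiv.conj_apply_apply, h1]

end HasLefschetzProperty

end Literature.Algebra.Lie
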